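import Mathlib.NumberTheory.ArithmeticFunction.Misc
import Mathlib.Data.Fin.Tuple.Finset
import Mathlib.Data.Fin.Tuple.Sort
import Mathlib.Analysis.Complex.Basic
import Literature.NumberTheory.Sieve.VaughanMeanValueDecomposition
import HarnessLib

/-!
# Sums over tuples: `piFinset` bookkeeping for multilinear Dirichlet-product expansions

Topic `Literature/NumberTheory/Sieve`; theorems only, everything PROVED (finite combinatorics).  When a
Dirichlet product `∏_{i < n} f_i` of arithmetic functions with finite supports `D_i` is summed against a weight
`h` over a finite set `S ⊆ ℕ_{≥ 1}`, the sum is a sum over tuples `t ∈ ∏ D_i` with `∏ t_i ∈ S`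
(`sum_prod_apply_mul_eq_sum_piFinset`).  This is the bookkeeping behind "group the variables of Heath-Brown's
identity into boxes" (Bombieri–Friedlander–Iwaniec, Acta Math. 156 (1986) §15; Drappeau, PLMS 114 (2017) §6.2),
written once for `Fin n`-indexed tuples, together with the elementary manipulations of `Fintype.piFinset` sums
that such arguments use:

* `sum_piFinset_succ`, `sum_piFinset_succ_last` — split off the first / last coordinate (`Fin.cons`, `Fin.snoc`);
* `sum_piFinset_biUnion` — a coordinatewise partition of the ranges is a partition of the tuple range;
* `sum_piFinset_image` — coordinatewise injective re-parametrisation;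
* `sum_piFinset_perm`, `exists_perm_monotone_sum_eq` — permuting the coordinates (e.g. by `Tuple.sort`);
* `sum_mul_apply_mul_eq` — the two-factor expansion `∑_{m ∈ S} (F ⋆ G)(m) h(m) = ∑_a ∑_b [ab ∈ S] F(a) G(b) h(ab)`;
* `sum_prod_apply_mul_eq_sum_piFinset` — the `n`-factor expansion.

## References

* E. Bombieri, J. B. Friedlander, H. Iwaniec, Acta Math. 156 (1986), 203–251, §15. [BombieriFriedlanderIwaniecActa1986]
-/

open Finset Fintype

namespace Literature.NumberTheory.Sieve

namespace TupleSums

variable {α M : Type*} [AddCommMonoid M]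

/-! ### Splitting off one coordinate -/

/-- Split off the first coordinate of a `piFinset` sum over `Fin (n+1)`-tuples. [folklore] -/
theorem sum_piFinset_succ {n : ℕ} (B : Fin (n + 1) → Finset α) (G : (Fin (n + 1) → α) → M) :
    ∑ f ∈ piFinset B, G f = ∑ a ∈ B 0, ∑ g ∈ piFinset (Fin.tail B), G (Fin.cons a g) := by
  rw [← Finset.sum_product' (f := fun a g => G (Fin.cons a g))]
  refine Finset.sum_equiv (Fin.consEquiv (fun _ => α)).symm (fun f => ?_) (fun f _ => ?_)
  · rw [Finset.mem_product]
    exact Fin.mem_piFinset_iff_zero_tail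
  · simp [Fin.consEquiv, Fin.cons_self_tail]

/-- Split off the last coordinate of a `piFinset` sum over `Fin (n+1)`-tuples. [folklore] -/
theorem sum_piFinset_succ_last {n : ℕ} (B : Fin (n + 1) → Finset α) (G : (Fin (n + 1) → α) → M) :
    ∑ f ∈ piFinset B, G f = ∑ g ∈ piFinset (Fin.init B), ∑ a ∈ B (Fin.last n), G (Fin.snoc g a) := by
  rw [Finset.sum_comm, ← Finset.sum_product' (f := fun a g => G (Fin.snoc g a))]
  refine Finset.sum_equiv (Fin.snocEquiv (fun _ => α)).symm (fun f => ?_) (fun f _ => ?_)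
  · rw [Finset.mem_product]
    exact Fin.mem_piFinset_iff_last_init
  · simp [Fin.snocEquiv, Fin.snoc_init_self]

/-! ### Coordinatewise partitions, images and permutations -/

/-- **A coordinatewise partition of the ranges partitions the tuples**: if the `i`-th range is the disjoint
union `⋃_{t ∈ T i} P i t`, then summing over tuples is summing over index tuples `t ∈ ∏ T i` and then over
`∏ P i (t i)`. [folklore] -/
theorem sum_piFinset_biUnion {ι τ : Type*} [Fintype ι] [DecidableEq ι] [DecidableEq α] [DecidableEq τ]
    (T : ι → Finset τ) (P : ι → τ → Finset α)
    (hdisj : ∀ i, ∀ t₁ ∈ T i, ∀ t₂ ∈ T i, t₁ ≠ t₂ → Disjoint (P i t₁) (P i t₂))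
    (G : (ι → α) → M) :
    ∑ f ∈ piFinset (fun i => (T i).biUnion (P i)), G f =
      ∑ t ∈ piFinset T, ∑ f ∈ piFinset (fun i => P i (t i)), G f := by
  rw [← Finset.sum_biUnion]
  · congr 1
    ext f
    simp only [mem_piFinset, mem_biUnion]
    constructor
    · intro h
      choose t ht using h
      exact ⟨t, fun i => (ht i).1, fun i => (ht i).2⟩
    · rintro ⟨t, ht, hf⟩ i
      exact ⟨t i, ht i, hf i⟩
  · intro t₁ ht₁ t₂ ht₂ hne
    have h' : ∃ i, t₁ i ≠ t₂ i := by
      by_contra h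
      push Not at h
      exact hne (funext h)
    obtain ⟨i, hi⟩ := h'
    exact piFinset_disjoint_of_disjoint _ _
      (hdisj i _ (mem_piFinset.1 (mem_coe.1 ht₁) i) _ (mem_piFinset.1 (mem_coe.1 ht₂) i) hi)

/-- **Coordinatewise injective re-parametrisation** of a tuple sum. [folklore] -/
theorem sum_piFinset_image {ι β : Type*} [Fintype ι] [DecidableEq ι] [DecidableEq α] [DecidableEq β]
    (Q : ι → Finset β) (h : ι → β → α) (hinj : ∀ i, Set.InjOn (h i) (Q i)) (G : (ι → α) → M) :
    ∑ f ∈ piFinset (fun i => (Q i).image (h i)), G f = ∑ g ∈ piFinset Q, G (fun i => h i (g i)) := by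
  rw [piFinset_image, Finset.sum_image]
  intro g₁ hg₁ g₂ hg₂ heq
  funext i
  exact hinj i (mem_piFinset.1 (mem_coe.1 hg₁) i) (mem_piFinset.1 (mem_coe.1 hg₂) i) (congr_fun heq i)

/-- **Permuting the coordinates** of a tuple sum: `∑_{f ∈ ∏ B_i} G(f) = ∑_{f' ∈ ∏ B_{σ i}} G(f' ∘ σ⁻¹)`
(`f' = f ∘ σ`). [folklore] -/
theorem sum_piFinset_perm {ι : Type*} [Fintype ι] [DecidableEq ι] (σ : Equiv.Perm ι) (B : ι → Finset α)
    (G : (ι → α) → M) :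
    ∑ f ∈ piFinset B, G f = ∑ f ∈ piFinset (fun i => B (σ i)), G (fun i => f (σ.symm i)) := by
  refine Finset.sum_equiv (Equiv.arrowCongr σ.symm (Equiv.refl α)) (fun f => ?_) (fun f _ => ?_)
  · simp only [mem_piFinset, Equiv.arrowCongr_apply, Equiv.coe_refl, Equiv.symm_symm,
      Function.comp_apply, id_eq]
    constructor
    · intro h i; exact h (σ i)
    · intro h i; simpa using h (σ.symm i)
  · simp [Equiv.arrowCongr_apply]

/-- Sorting the coordinates: for `V : Fin n → β` (`β` linearly ordered) there is a permutation `σ` with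
`V ∘ σ` monotone, and every tuple sum can be rewritten over the permuted ranges (`Tuple.sort`). [folklore] -/
theorem exists_perm_monotone_sum_eq {n : ℕ} {β : Type*} [LinearOrder β] (V : Fin n → β) (B : Fin n → Finset α)
    (G : (Fin n → α) → M) :
    ∃ σ : Equiv.Perm (Fin n), Monotone (V ∘ σ) ∧
      ∑ f ∈ piFinset B, G f = ∑ f ∈ piFinset (fun i => B (σ i)), G (fun i => f (σ.symm i)) :=
  ⟨Tuple.sort V, Tuple.monotone_sort V, sum_piFinset_perm _ B G⟩

/-! ### Multilinear expansion of Dirichlet products -/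

/-- **Two-factor expansion**: for a finite set `S` of positive integers, all `≤ N`,
`∑_{m ∈ S} (F ⋆ G)(m) h(m) = ∑_{a ≤ N} ∑_{b ≤ N/a} [ab ∈ S] F(a) G(b) h(ab)`. [folklore] -/
theorem sum_mul_apply_mul_eq (F G : ArithmeticFunction ℝ) (S : Finset ℕ) {N : ℕ} (hS0 : 0 ∉ S)
    (hSN : ∀ m ∈ S, m ≤ N) (h : ℕ → ℂ) :
    ∑ m ∈ S, ((F * G) m : ℂ) * h m =
      ∑ a ∈ Ioc 0 N, ∑ b ∈ Ioc 0 (N / a), if a * b ∈ S then (F a : ℂ) * (G b : ℂ) * h (a * b) else 0 := by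
  have hsub : S ⊆ Ioc 0 N := fun m hm => by
    rw [mem_Ioc]
    exact ⟨Nat.pos_of_ne_zero fun h0 => hS0 (h0 ▸ hm), hSN m hm⟩
  rw [← Vaughan.sum_Ioc_sum_divisorsAntidiagonal_eq
    (fun a b => if a * b ∈ S then (F a : ℂ) * (G b : ℂ) * h (a * b) else 0) N]
  calc ∑ m ∈ S, ((F * G) m : ℂ) * h m
      = ∑ m ∈ (Ioc 0 N).filter (· ∈ S), ((F * G) m : ℂ) * h m := by
        rw [Finset.filter_mem_eq_inter, Finset.inter_eq_right.2 hsub]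
    _ = ∑ m ∈ Ioc 0 N, if m ∈ S then ((F * G) m : ℂ) * h m else 0 := Finset.sum_filter _ _
    _ = _ := by
        refine Finset.sum_congr rfl fun n _ => ?_
        by_cases hn : n ∈ S
        · rw [if_pos hn, ArithmeticFunction.mul_apply, Complex.ofReal_sum, Finset.sum_mul]
          refine Finset.sum_congr rfl fun p hp => ?_
          rw [Nat.mem_divisorsAntidiagonal] at hp
          rw [hp.1, if_pos hn, Complex.ofReal_mul]
        · rw [if_neg hn]
          symm
          refine Finset.sum_eq_zero fun p hp => ?_
          rw [Nat.mem_divisorsAntidiagonal] at hp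
          rw [hp.1, if_neg hn]

/-- **Multilinear expansion of a Dirichlet product into tuples.**  Let `f : Fin n → ArithmeticFunction ℝ` have
finite supports, `f i m ≠ 0 → m ∈ D i`, and let `S` be a finite set of positive integers.  Then
`∑_{m ∈ S} (∏_i f_i)(m) h(m) = ∑_{t ∈ ∏_i D_i} [∏_i t_i ∈ S] (∏_i f_i(t_i)) h(∏_i t_i)`.
[cite: BombieriFriedlanderIwaniecActa1986, §15 p. 245–246] -/
theorem sum_prod_apply_mul_eq_sum_piFinset :
    ∀ (n : ℕ) (f : Fin n → ArithmeticFunction ℝ) (D : Fin n → Finset ℕ)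
      (_hD : ∀ i m, f i m ≠ 0 → m ∈ D i) (S : Finset ℕ) (_hS0 : 0 ∉ S) (h : ℕ → ℂ),
      ∑ m ∈ S, ((∏ i, f i) m : ℂ) * h m =
        ∑ t ∈ piFinset D, if (∏ i, t i) ∈ S then (∏ i, (f i (t i) : ℂ)) * h (∏ i, t i) else 0 := by
  intro n
  induction n with
  | zero =>
      intro f D hD S hS0 h
      simp only [Finset.univ_eq_empty, Finset.prod_empty]
      rw [show piFinset D = {fun i => Fin.elim0 i} from ?_]
      · rw [Finset.sum_singleton]
        by_cases h1 : (1 : ℕ) ∈ S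
        · rw [if_pos h1, ← Finset.sum_erase_add _ _ h1, ArithmeticFunction.one_apply, if_pos rfl,
            Finset.sum_eq_zero]
          · simp
          · intro m hm
            rw [Finset.mem_erase] at hm
            rw [ArithmeticFunction.one_apply, if_neg hm.1]
            simp
        · rw [if_neg h1]
          refine Finset.sum_eq_zero fun m hm => ?_
          rw [ArithmeticFunction.one_apply, if_neg (fun hm1 : m = 1 => h1 (hm1 ▸ hm))]
          simp
      · ext t
        simp only [mem_piFinset, Finset.mem_singleton, IsEmpty.forall_iff, true_iff]
        funext i; exact Fin.elim0 i
  | succ n ih =>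
      intro f D hD S hS0 h
      -- the largest element of `S`
      set N := S.sup id with hN
      have hSN : ∀ m ∈ S, m ≤ N := fun m hm => Finset.le_sup (f := id) hm
      rw [Fin.prod_univ_succ, sum_mul_apply_mul_eq _ _ S hS0 hSN h]
      -- expand the inner factor by induction, for each `a`
      have hinner : ∀ a ∈ Ioc 0 N,
          (∑ b ∈ Ioc 0 (N / a), if a * b ∈ S then
              (f 0 a : ℂ) * ((∏ i : Fin n, f i.succ) b : ℂ) * h (a * b) else 0) =
            (f 0 a : ℂ) * ∑ t ∈ piFinset (Fin.tail D),
              if a * ∏ i, t i ∈ S then (∏ i, (f i.succ (t i) : ℂ)) * h (a * ∏ i, t i) else 0 := by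
        intro a ha
        rw [mem_Ioc] at ha
        set Sa : Finset ℕ := (Ioc 0 (N / a)).filter (fun b => a * b ∈ S) with hSa
        have hSa0 : 0 ∉ Sa := by simp [hSa]
        have key := ih (fun i => f i.succ) (Fin.tail D) (fun i m hm => hD i.succ m hm) Sa hSa0
          (fun b => h (a * b))
        have lhs : (∑ b ∈ Ioc 0 (N / a), if a * b ∈ S then
              (f 0 a : ℂ) * ((∏ i : Fin n, f i.succ) b : ℂ) * h (a * b) else 0) =
            (f 0 a : ℂ) * ∑ b ∈ Sa, ((∏ i : Fin n, f i.succ) b : ℂ) * h (a * b) := by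
          rw [hSa, Finset.sum_filter, Finset.mul_sum]
          refine Finset.sum_congr rfl fun b _ => ?_
          split_ifs <;> ring
        rw [lhs, key]
        congr 1
        refine Finset.sum_congr rfl fun t _ => ?_
        have hiff : (∏ i, t i) ∈ Sa ↔ a * ∏ i, t i ∈ S := by
          rw [hSa, Finset.mem_filter, mem_Ioc]
          constructor
          · exact fun hh => hh.2
          · intro hh
            have hpos : a * ∏ i, t i ≠ 0 := fun h0 => hS0 (h0 ▸ hh)
            have hb : (∏ i, t i) ≠ 0 := fun h0 => hpos (by rw [h0, mul_zero])
            refine ⟨⟨Nat.pos_of_ne_zero hb, ?_⟩, hh⟩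
            rw [Nat.le_div_iff_mul_le ha.1, mul_comm]
            exact hSN _ hh
        by_cases hc : a * ∏ i, t i ∈ S
        · rw [if_pos (hiff.2 hc), if_pos hc]
        · rw [if_neg (fun hh => hc (hiff.1 hh)), if_neg hc]
      rw [Finset.sum_congr rfl hinner]
      -- pass from `a ∈ Ioc 0 N` to `a ∈ D 0`: both sums equal the sum over the intersection
      set Ψ : ℕ → ℂ := fun a => (f 0 a : ℂ) * ∑ t ∈ piFinset (Fin.tail D),
          (if a * ∏ i, t i ∈ S then (∏ i, (f i.succ (t i) : ℂ)) * h (a * ∏ i, t i) else 0) with hΨ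
      have hleft : ∑ a ∈ Ioc 0 N ∩ D 0, Ψ a = ∑ a ∈ Ioc 0 N, Ψ a := by
        refine Finset.sum_subset Finset.inter_subset_left fun a _ ha' => ?_
        have haD : a ∉ D 0 := fun hh => ha' (Finset.mem_inter.2 ⟨‹a ∈ Ioc 0 N›, hh⟩)
        have hf0 : f 0 a = 0 := by
          by_contra hne
          exact haD (hD 0 a hne)
        simp [hΨ, hf0]
      have hright : ∑ a ∈ Ioc 0 N ∩ D 0, Ψ a = ∑ a ∈ D 0, Ψ a := by
        refine Finset.sum_subset Finset.inter_subset_right fun a haD ha' => ?_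
        have haI : a ∉ Ioc 0 N := fun hh => ha' (Finset.mem_inter.2 ⟨hh, haD⟩)
        rw [mem_Ioc, not_and_or, not_lt, not_le] at haI
        rcases haI with ha0 | haN
        · have : a = 0 := by omega
          simp [hΨ, this]
        · have hzero : ∀ t ∈ piFinset (Fin.tail D),
              (if a * ∏ i, t i ∈ S then (∏ i, (f i.succ (t i) : ℂ)) * h (a * ∏ i, t i) else 0) = 0 := by
            intro t _
            rw [if_neg]
            intro hh
            have hle := hSN _ hh
            have hpos : a * ∏ i, t i ≠ 0 := fun h0 => hS0 (h0 ▸ hh)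
            have hb : 1 ≤ ∏ i, t i := Nat.pos_of_ne_zero fun h0 => hpos (by rw [h0, mul_zero])
            have : a ≤ a * ∏ i, t i := Nat.le_mul_of_pos_right a hb
            omega
          rw [hΨ]
          simp only
          rw [Finset.sum_congr rfl hzero, Finset.sum_const_zero, mul_zero]
      rw [← hleft, hright, sum_piFinset_succ D]
      refine Finset.sum_congr rfl fun a _ => ?_
      rw [hΨ]
      simp only
      rw [Finset.mul_sum]
      refine Finset.sum_congr rfl fun g _ => ?_
      have hprod : (∏ i, (Fin.cons a g : Fin (n + 1) → ℕ) i) = a * ∏ i, g i := by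
        rw [Fin.prod_univ_succ]
        simp
      have hprodf : (∏ i, (f i ((Fin.cons a g : Fin (n + 1) → ℕ) i) : ℂ)) =
          (f 0 a : ℂ) * ∏ i : Fin n, (f i.succ (g i) : ℂ) := by
        rw [Fin.prod_univ_succ]
        simp
      rw [hprod, hprodf]
      split_ifs <;> ring

end TupleSums

end Literature.NumberTheory.Sieve
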